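import Summits.QuantumFields.YangMills.Theorems.EquipartitionCriticalityFreeEnergyLogCoefficientExpChartMeasure
import HarnessLib

/-!
# The exponential chart of a compact matrix group: comparison of Haar and Lebesgue integrals near `1`

Crux `FreeEnergyLogCoefficient` of route `EquipartitionCriticality` (`QuantumFields/YangMills`), line
`Sketch`, stub `stub_expChartPackage`, fourth file (template: `UnitaryCayleyChart`, §§Comparison/Pi).
With `ν = chartMeasureE ρ (1/4)`, `c_H = haarConstE ρ` and the distortion `κE`:

* `chartMeasureE_le` (`ν ≤ c_H vol`), `le_chartMeasureE_of_subset` (`c_H κE(r)^{-D} vol ≤ ν` on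
  `b(0, r)`, `r ≤ r₁`) by the Vitali covering lemma (Chatterjee Thm. 11.1, soft constant);
* `haar_restrict_image_expChart`, `lintegral_pi_image_expChart_le`, `le_lintegral_pi_image_expChart`:
  the transfer of (product) Haar integrals over chart images to Lebesgue integrals (Thm. 11.1, second
  assertion);
* `exists_haar_gball_ge` (Cor. 6.3, lower half, soft constant);
* `stub_expChartPackage` — the registered stub of the line, assembling the package.

Reference: S. Chatterjee, arXiv:1602.01222, §6 (Cor. 6.3), §11 (Thm. 11.1).
-/

noncomputable section

open scoped Matrix Matrix.Norms.Frobenius Topology ENNReal NNReal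
open NormedSpace Filter Set MeasureTheory Measure Metric Function
open Literature.MathematicalPhysics.QuantumLattice Literature.MathematicalPhysics.QuantumFieldTheory

namespace Summit.QuantumFields.YangMills.Theorems.FreeEnergyLogCoefficient

-- NEEDS ExpChart
-- BODY START
section Compare

variable {N : ℕ} {G : Type*} [Group G] [TopologicalSpace G] [IsTopologicalGroup G] [CompactSpace G]
  [MeasurableSpace G] [BorelSpace G] (ρ : G →* (Matrix (Fin N) (Fin N) ℂ))

/-! ### Upper comparison `ν ≤ c_H vol` -/

/-- **Upper comparison** (Chatterjee Thm. 11.1, upper bound, soft constant): `ν(s) ≤ c_H vol(s)` for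
every `s`. [cite: arXiv160201222, Thm. 11.1 (analogue)] -/
theorem chartMeasureE_le (hρ : Continuous ρ) (hinj : Function.Injective ρ)
    (hU : ∀ g, ρ g ∈ Matrix.unitaryGroup (Fin N) ℂ) (s : Set (EuclideanSpace ℝ (Fin (dimE ρ)))) :
    chartMeasureE ρ (1 / 4) s ≤ haarConstE ρ * volume s := by
  haveI := isFiniteMeasure_chartMeasureE ρ hρ hinj
  obtain ⟨hc0, hctop, hT⟩ := haarConstE_spec ρ hρ hinj hU
  set c : ℝ≥0 := (haarConstE ρ).toNNReal with hc
  have hcc : (c : ℝ≥0∞) = haarConstE ρ := ENNReal.coe_toNNReal hctop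
  have hcpos : 0 < c := by
    refine pos_iff_ne_zero.2 fun h0 => hc0 ?_
    rw [← hcc, h0, ENNReal.coe_zero]
  rw [← hcc] at hT ⊢
  have hk : ∀ k : ℝ≥0, c < k → chartMeasureE ρ (1 / 4) s ≤ k * volume s := by
    intro k hk
    have hfreq : ∀ x ∈ s, ∃ᶠ t in (Besicovitch.vitaliFamily (chartMeasureE ρ (1 / 4))).filterAt x,
        chartMeasureE ρ (1 / 4) t ≤ (k • (volume : Measure (EuclideanSpace ℝ (Fin (dimE ρ))))) t := by
      intro x _
      have hev : ∀ᶠ δ in 𝓝[>] (0 : ℝ), chartMeasureE ρ (1 / 4) (closedBall x δ) ≤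
          (k • (volume : Measure (EuclideanSpace ℝ (Fin (dimE ρ))))) (closedBall x δ) := by
        filter_upwards [hT.eventually_lt_const (show ((c : ℝ≥0) : ℝ≥0∞) < k by exact_mod_cast hk),
          self_mem_nhdsWithin] with δ hδ hδ0
        have h := (ratio_le_ballRatioE ρ hρ hinj hU x δ).trans_lt hδ
        rw [ENNReal.div_lt_iff (Or.inl (volume_closedBall_fin_pos x hδ0).ne')
          (Or.inl (volume_closedBall_fin_lt_top x δ).ne)] at h
        rw [Measure.coe_nnreal_smul_apply]
        exact h.le
      exact (Besicovitch.tendsto_filterAt (chartMeasureE ρ (1 / 4)) x).frequently hev.frequently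
    have hle := (Besicovitch.vitaliFamily (chartMeasureE ρ (1 / 4))).measure_le_of_frequently_le
      (k • (volume : Measure (EuclideanSpace ℝ (Fin (dimE ρ))))) Measure.AbsolutelyContinuous.rfl s hfreq
    rwa [Measure.coe_nnreal_smul_apply] at hle
  refine ENNReal.le_of_forall_lt_one_mul_le fun a ha => ?_
  rcases eq_or_ne a 0 with rfl | ha0
  · simp
  have hafin : a ≠ ∞ := ne_top_of_lt ha
  set a' : ℝ≥0 := a.toNNReal with ha'
  have haa : (a' : ℝ≥0∞) = a := ENNReal.coe_toNNReal hafin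
  have ha'0 : a' ≠ 0 := by
    intro h; rw [h, ENNReal.coe_zero] at haa; exact ha0 haa.symm
  have ha'1 : a' < 1 := by
    rw [← ENNReal.coe_lt_coe, haa, ENNReal.coe_one]; exact ha
  have hk' : c < c / a' := lt_div_iff₀ (pos_iff_ne_zero.2 ha'0) |>.2 (mul_lt_of_lt_one_right hcpos ha'1)
  calc a * chartMeasureE ρ (1 / 4) s ≤ a * ((c / a' : ℝ≥0) * volume s) := by gcongr; exact hk _ hk'
    _ = c * volume s := by rw [← mul_assoc, ← haa, ← ENNReal.coe_mul, mul_div_cancel₀ _ ha'0]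

/-! ### Lower comparison on `b(0, r)` -/

/-- `κE(r)^{-D} g(δ/κE(r)) ≤ ν(b(x,δ))/vol(b(x,δ))` for `‖x‖ ≤ r ≤ r₁`, `0 < δ ≤ r`. [cite: arXiv160201222, §11 (proof of Thm. 11.1)] -/
theorem inv_mul_ballRatioE_le (hρ : Continuous ρ) (hinj : Function.Injective ρ)
    (hU : ∀ g, ρ g ∈ Matrix.unitaryGroup (Fin N) ℂ) {r₁ : ℝ} (hr₁ : r₁ ≤ 1 / 16)
    (hsurj : ∀ g : G, ‖ρ g - 1‖ ≤ 2 * r₁ → ∃ a : (EuclideanSpace ℝ (Fin (dimE ρ))), expChart ρ a = g ∧ ‖a‖ ≤ 2 * ‖ρ g - 1‖)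
    {r δ : ℝ} (hr : r ≤ r₁) {x : (EuclideanSpace ℝ (Fin (dimE ρ)))} (hx : ‖x‖ ≤ r) (hδ : 0 < δ) (hδr : δ ≤ r) :
    (ENNReal.ofReal (κE r ^ dimE ρ))⁻¹ * ballRatioE ρ (δ / κE r) ≤
      chartMeasureE ρ (1 / 4) (closedBall x δ) / volume (closedBall x δ) := by
  have hr0 : 0 ≤ r := (norm_nonneg x).trans hx
  have hκ := κE_pos hr0
  have h := ballRatioE_le ρ hρ hinj hU hr₁ hsurj hr hx (div_pos hδ hκ)
    (by rw [mul_div_cancel₀ _ hκ.ne']; exact hδr)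
  rw [mul_div_cancel₀ _ hκ.ne'] at h
  have hK0 : ENNReal.ofReal (κE r ^ dimE ρ) ≠ 0 := by
    rw [ENNReal.ofReal_ne_zero_iff]; positivity
  calc (ENNReal.ofReal (κE r ^ dimE ρ))⁻¹ * ballRatioE ρ (δ / κE r)
      ≤ (ENNReal.ofReal (κE r ^ dimE ρ))⁻¹ * (ENNReal.ofReal (κE r ^ dimE ρ) *
          (chartMeasureE ρ (1 / 4) (closedBall x δ) / volume (closedBall x δ))) := by gcongr
    _ = chartMeasureE ρ (1 / 4) (closedBall x δ) / volume (closedBall x δ) := by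
        rw [← mul_assoc, ENNReal.inv_mul_cancel hK0 ENNReal.ofReal_ne_top, one_mul]

/-- **Lower comparison** (Chatterjee Thm. 11.1, lower bound, soft constant):
`c_H κE(r)^{-D} vol(s) ≤ ν(s)` for `s ⊆ b(0, r)`, `0 < r ≤ r₁`. [cite: arXiv160201222, Thm. 11.1 (analogue)] -/
theorem le_chartMeasureE_of_subset (hρ : Continuous ρ) (hinj : Function.Injective ρ)
    (hU : ∀ g, ρ g ∈ Matrix.unitaryGroup (Fin N) ℂ) {r₁ : ℝ} (hr₁ : r₁ ≤ 1 / 16)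
    (hsurj : ∀ g : G, ‖ρ g - 1‖ ≤ 2 * r₁ → ∃ a : (EuclideanSpace ℝ (Fin (dimE ρ))), expChart ρ a = g ∧ ‖a‖ ≤ 2 * ‖ρ g - 1‖)
    {r : ℝ} (hr : 0 < r) (hrr : r ≤ r₁) {s : Set (EuclideanSpace ℝ (Fin (dimE ρ)))} (hs : s ⊆ closedBall 0 r) :
    (ENNReal.ofReal (κE r ^ dimE ρ))⁻¹ * haarConstE ρ * volume s ≤ chartMeasureE ρ (1 / 4) s := by
  haveI := isFiniteMeasure_chartMeasureE ρ hρ hinj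
  obtain ⟨hc0, hctop, hTc⟩ := haarConstE_spec ρ hρ hinj hU
  have hκ := κE_pos hr.le
  set lc : ℝ≥0∞ := (ENNReal.ofReal (κE r ^ dimE ρ))⁻¹ * haarConstE ρ with hlc
  have hK0 : ENNReal.ofReal (κE r ^ dimE ρ) ≠ 0 := by
    rw [ENNReal.ofReal_ne_zero_iff]; positivity
  have hlc0 : lc ≠ 0 := mul_ne_zero (ENNReal.inv_ne_zero.2 ENNReal.ofReal_ne_top) hc0
  have hlctop : lc ≠ ∞ := ENNReal.mul_ne_top (ENNReal.inv_ne_top.2 hK0) hctop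
  have hT : Tendsto (fun δ => (ENNReal.ofReal (κE r ^ dimE ρ))⁻¹ * ballRatioE ρ (δ / κE r))
      (𝓝[>] 0) (𝓝 lc) := by
    refine ENNReal.Tendsto.const_mul (hTc.comp ?_) (Or.inr (ENNReal.inv_ne_top.2 hK0))
    simpa only [div_eq_inv_mul] using UnitaryCayley.tendsto_const_mul_nhdsGT (inv_pos.2 hκ)
  have hk : ∀ k : ℝ≥0, (k : ℝ≥0∞) < lc → (k : ℝ≥0∞) * volume s ≤ chartMeasureE ρ (1 / 4) s := by
    intro k hk
    have hfreq : ∀ x ∈ s, ∃ᶠ t in (Besicovitch.vitaliFamily (volume : Measure (EuclideanSpace ℝ (Fin (dimE ρ))))).filterAt x,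
        ((k : ℝ≥0∞) • (volume : Measure (EuclideanSpace ℝ (Fin (dimE ρ))))) t ≤ chartMeasureE ρ (1 / 4) t := by
      intro x hx
      have hxr : ‖x‖ ≤ r := by simpa [mem_closedBall, dist_zero_right] using hs hx
      have hev : ∀ᶠ δ in 𝓝[>] (0 : ℝ), ((k : ℝ≥0∞) • (volume : Measure (EuclideanSpace ℝ (Fin (dimE ρ))))) (closedBall x δ) ≤
          chartMeasureE ρ (1 / 4) (closedBall x δ) := by
        filter_upwards [hT.eventually_const_lt hk, Ioc_mem_nhdsGT hr] with δ hδ hδr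
        have h := hδ.trans_le (inv_mul_ballRatioE_le ρ hρ hinj hU hr₁ hsurj hrr hxr hδr.1 hδr.2)
        rw [ENNReal.lt_div_iff_mul_lt (Or.inl (volume_closedBall_fin_pos x hδr.1).ne')
          (Or.inl (volume_closedBall_fin_lt_top x δ).ne)] at h
        rw [Measure.smul_apply, smul_eq_mul]
        exact h.le
      exact (Besicovitch.tendsto_filterAt volume x).frequently hev.frequently
    have hle := (Besicovitch.vitaliFamily (volume : Measure (EuclideanSpace ℝ (Fin (dimE ρ))))).measure_le_of_frequently_le
      (chartMeasureE ρ (1 / 4)) (smul_absolutelyContinuous (c := (k : ℝ≥0∞))) s hfreq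
    rwa [Measure.smul_apply, smul_eq_mul] at hle
  refine ENNReal.le_of_forall_lt_one_mul_le fun a ha => ?_
  have hafin : a ≠ ∞ := ne_top_of_lt ha
  have hfin : a * lc ≠ ∞ := ENNReal.mul_ne_top hafin hlctop
  rcases eq_or_ne a 0 with rfl | ha0
  · simp
  have hlt : a * lc < lc := by
    conv_rhs => rw [← one_mul lc]
    exact ENNReal.mul_lt_mul_left hlc0 hlctop ha
  have h := hk (a * lc).toNNReal (by rwa [ENNReal.coe_toNNReal hfin])
  rw [ENNReal.coe_toNNReal hfin] at h
  rwa [← mul_assoc]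

/-! ### Transfer of (product) integrals to the chart -/

/-- **Haar measure on a chart image is the image of the chart measure**: for `B ⊆ b(0, 1/4)`,
`σ|_{ψ(B)} = ψ_* (ν|_B)`. [folklore] -/
theorem haar_restrict_image_expChart (hρ : Continuous ρ) (hinj : Function.Injective ρ) {B : Set (EuclideanSpace ℝ (Fin (dimE ρ)))}
    (hB : B ⊆ (Metric.closedBall (0 : (EuclideanSpace ℝ (Fin (dimE ρ)))) (1 / 4))) :
    (haarProbability G).restrict (expChart ρ '' B) =
      Measure.map (expChart ρ) ((chartMeasureE ρ (1 / 4)).restrict B) := by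
  have hm := measurable_expChart ρ hρ hinj
  ext A hA
  rw [Measure.restrict_apply hA, Measure.map_apply hm hA, Measure.restrict_apply (hm hA),
    chartMeasureE_apply ρ hρ hinj, inter_assoc, inter_eq_self_of_subset_left hB, image_preimage_inter]

variable {ι : Type*} [Fintype ι]

/-- The product Haar measure restricted to a product of chart images is the image of the product of the
restricted chart measures. [folklore] -/
theorem pi_haar_restrict_image_expChart (hρ : Continuous ρ) (hinj : Function.Injective ρ)
    {B : Set (EuclideanSpace ℝ (Fin (dimE ρ)))} (hB : B ⊆ (Metric.closedBall (0 : (EuclideanSpace ℝ (Fin (dimE ρ)))) (1 / 4))) :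
    (Measure.pi fun _ : ι => haarProbability G).restrict (Set.pi univ fun _ => expChart ρ '' B) =
      Measure.map (fun a : ι → (EuclideanSpace ℝ (Fin (dimE ρ))) => fun i => expChart ρ (a i))
        (Measure.pi fun _ : ι => (chartMeasureE ρ (1 / 4)).restrict B) := by
  haveI := isFiniteMeasure_chartMeasureE ρ hρ hinj
  rw [Measure.restrict_pi_pi]
  simp only [haar_restrict_image_expChart ρ hρ hinj hB]
  rw [← Measure.pi_map_pi fun _ => (measurable_expChart ρ hρ hinj).aemeasurable]

omit [IsTopologicalGroup G] [Fintype ι] in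
/-- The coordinatewise chart is measurable. [folklore] -/
theorem measurable_expChartPi (hρ : Continuous ρ) (hinj : Function.Injective ρ) :
    Measurable fun a : ι → (EuclideanSpace ℝ (Fin (dimE ρ))) => fun i => expChart ρ (a i) :=
  measurable_pi_lambda _ fun i => (measurable_expChart ρ hρ hinj).comp (measurable_pi_apply i)

/-- Transfer of product integrals to the chart: for `B ⊆ b(0, 1/4)`,
`∫_{ψ(B)^ι} F dσ^ι = ∫ F(ψ ∘ a) d(ν|_B)^ι(a)`. [folklore] -/
theorem lintegral_pi_image_expChart (hρ : Continuous ρ) (hinj : Function.Injective ρ) {B : Set (EuclideanSpace ℝ (Fin (dimE ρ)))}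
    (hB : B ⊆ (Metric.closedBall (0 : (EuclideanSpace ℝ (Fin (dimE ρ)))) (1 / 4))) {F : (ι → G) → ℝ≥0∞} (hF : Measurable F) :
    ∫⁻ U in Set.pi univ (fun _ => expChart ρ '' B), F U ∂(Measure.pi fun _ : ι => haarProbability G) =
      ∫⁻ a, F (fun i => expChart ρ (a i)) ∂(Measure.pi fun _ : ι => (chartMeasureE ρ (1 / 4)).restrict B) := by
  rw [pi_haar_restrict_image_expChart ρ hρ hinj hB, lintegral_map hF (measurable_expChartPi ρ hρ hinj)]

omit [TopologicalSpace G] [IsTopologicalGroup G] [CompactSpace G] [MeasurableSpace G] [BorelSpace G] in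
/-- Balls of radius `≤ 1/4` around `0` lie in `b(0, 1/4)`. [folklore] -/
theorem closedBall_subset_T {r : ℝ} (hr : r ≤ 1 / 4) :
    closedBall (0 : (EuclideanSpace ℝ (Fin (dimE ρ)))) r ⊆
      (Metric.closedBall (0 : (EuclideanSpace ℝ (Fin (dimE ρ)))) (1 / 4)) :=
  closedBall_subset_closedBall hr

/-- **Upper bound for product integrals near the identity** (Chatterjee Thm. 11.1, second assertion,
upper half, soft constant): for measurable `F ≥ 0` and `r ≤ 1/4`,
`∫_{ψ(b(0,r))^ι} F dσ^ι ≤ c_H^{#ι} ∫_{b(0,r)^ι} F(ψ ∘ a) da`. [cite: arXiv160201222, Thm. 11.1 (analogue)] -/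
theorem lintegral_pi_image_expChart_le (hρ : Continuous ρ) (hinj : Function.Injective ρ)
    (hU : ∀ g, ρ g ∈ Matrix.unitaryGroup (Fin N) ℂ) {r : ℝ} (hr : r ≤ 1 / 4)
    {F : (ι → G) → ℝ≥0∞} (hF : Measurable F) :
    ∫⁻ U in Set.pi univ (fun _ => expChart ρ '' closedBall 0 r), F U
        ∂(Measure.pi fun _ : ι => haarProbability G) ≤
      haarConstE ρ ^ Fintype.card ι *
        ∫⁻ a in Set.pi univ (fun _ => closedBall (0 : (EuclideanSpace ℝ (Fin (dimE ρ)))) r), F (fun i => expChart ρ (a i)) := by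
  haveI := isFiniteMeasure_chartMeasureE ρ hρ hinj
  obtain ⟨-, hctop, -⟩ := haarConstE_spec ρ hρ hinj hU
  set c : ℝ≥0 := (haarConstE ρ).toNNReal with hc
  have hcc : (c : ℝ≥0∞) = haarConstE ρ := ENNReal.coe_toNNReal hctop
  have hcomp : (chartMeasureE ρ (1 / 4)).restrict (closedBall 0 r) ≤
      c • (volume : Measure (EuclideanSpace ℝ (Fin (dimE ρ)))).restrict (closedBall 0 r) := by
    refine Measure.le_iff.2 fun s hs => ?_
    rw [Measure.restrict_apply hs, Measure.coe_nnreal_smul_apply, Measure.restrict_apply hs, hcc]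
    exact chartMeasureE_le ρ hρ hinj hU _
  rw [lintegral_pi_image_expChart ρ hρ hinj (closedBall_subset_T ρ hr) hF]
  calc ∫⁻ a, F (fun i => expChart ρ (a i)) ∂(Measure.pi fun _ : ι => (chartMeasureE ρ (1 / 4)).restrict (closedBall 0 r))
      ≤ ∫⁻ a, F (fun i => expChart ρ (a i)) ∂(Measure.pi fun _ : ι =>
          c • (volume : Measure (EuclideanSpace ℝ (Fin (dimE ρ)))).restrict (closedBall 0 r)) :=
        lintegral_mono' (UnitaryCayley.pi_mono _ _ fun _ => hcomp) le_rfl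
    _ = haarConstE ρ ^ Fintype.card ι *
          ∫⁻ a in Set.pi univ (fun _ => closedBall (0 : (EuclideanSpace ℝ (Fin (dimE ρ)))) r), F (fun i => expChart ρ (a i)) := by
        rw [UnitaryCayley.pi_const_smul, lintegral_smul_measure, volume_pi, ← Measure.restrict_pi_pi,
          ← hcc, ENNReal.smul_def, ENNReal.coe_pow]
        rfl

/-- **Lower bound for product integrals near the identity** (Chatterjee Thm. 11.1, second assertion,
lower half, soft constant): for measurable `F ≥ 0` and `0 < r ≤ r₁`,
`(c_H κE(r)^{-D})^{#ι} ∫_{b(0,r)^ι} F(ψ ∘ a) da ≤ ∫_{ψ(b(0,r))^ι} F dσ^ι`. [cite: arXiv160201222, Thm. 11.1 (analogue)] -/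
theorem le_lintegral_pi_image_expChart (hρ : Continuous ρ) (hinj : Function.Injective ρ)
    (hU : ∀ g, ρ g ∈ Matrix.unitaryGroup (Fin N) ℂ) {r₁ : ℝ} (hr₁ : r₁ ≤ 1 / 16)
    (hsurj : ∀ g : G, ‖ρ g - 1‖ ≤ 2 * r₁ → ∃ a : (EuclideanSpace ℝ (Fin (dimE ρ))), expChart ρ a = g ∧ ‖a‖ ≤ 2 * ‖ρ g - 1‖)
    {r : ℝ} (hr : 0 < r) (hrr : r ≤ r₁) {F : (ι → G) → ℝ≥0∞} (hF : Measurable F) :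
    ((ENNReal.ofReal (κE r ^ dimE ρ))⁻¹ * haarConstE ρ) ^ Fintype.card ι *
        ∫⁻ a in Set.pi univ (fun _ => closedBall (0 : (EuclideanSpace ℝ (Fin (dimE ρ)))) r), F (fun i => expChart ρ (a i)) ≤
      ∫⁻ U in Set.pi univ (fun _ => expChart ρ '' closedBall 0 r), F U
        ∂(Measure.pi fun _ : ι => haarProbability G) := by
  haveI := isFiniteMeasure_chartMeasureE ρ hρ hinj
  obtain ⟨-, hctop, -⟩ := haarConstE_spec ρ hρ hinj hU
  have hK0 : ENNReal.ofReal (κE r ^ dimE ρ) ≠ 0 := by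
    rw [ENNReal.ofReal_ne_zero_iff]; exact pow_pos (κE_pos hr.le) _
  have hlctop : (ENNReal.ofReal (κE r ^ dimE ρ))⁻¹ * haarConstE ρ ≠ ∞ :=
    ENNReal.mul_ne_top (ENNReal.inv_ne_top.2 hK0) hctop
  have hrT : r ≤ 1 / 4 := by linarith
  rw [lintegral_pi_image_expChart ρ hρ hinj (closedBall_subset_T ρ hrT) hF]
  set l : ℝ≥0 := ((ENNReal.ofReal (κE r ^ dimE ρ))⁻¹ * haarConstE ρ).toNNReal with hl
  have hll : (l : ℝ≥0∞) = (ENNReal.ofReal (κE r ^ dimE ρ))⁻¹ * haarConstE ρ := ENNReal.coe_toNNReal hlctop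
  have hcomp : l • (volume : Measure (EuclideanSpace ℝ (Fin (dimE ρ)))).restrict (closedBall 0 r) ≤
      (chartMeasureE ρ (1 / 4)).restrict (closedBall 0 r) := by
    refine Measure.le_iff.2 fun s hs => ?_
    rw [Measure.restrict_apply hs, Measure.coe_nnreal_smul_apply, Measure.restrict_apply hs, hll]
    exact le_chartMeasureE_of_subset ρ hρ hinj hU hr₁ hsurj hr hrr inter_subset_right
  calc ((ENNReal.ofReal (κE r ^ dimE ρ))⁻¹ * haarConstE ρ) ^ Fintype.card ι *
        ∫⁻ a in Set.pi univ (fun _ => closedBall (0 : (EuclideanSpace ℝ (Fin (dimE ρ)))) r), F (fun i => expChart ρ (a i))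
      = ∫⁻ a, F (fun i => expChart ρ (a i)) ∂(Measure.pi fun _ : ι =>
          l • (volume : Measure (EuclideanSpace ℝ (Fin (dimE ρ)))).restrict (closedBall 0 r)) := by
        rw [UnitaryCayley.pi_const_smul, lintegral_smul_measure, volume_pi, ← Measure.restrict_pi_pi,
          ← hll, ENNReal.smul_def, ENNReal.coe_pow]
        rfl
    _ ≤ ∫⁻ a, F (fun i => expChart ρ (a i)) ∂(Measure.pi fun _ : ι =>
          (chartMeasureE ρ (1 / 4)).restrict (closedBall 0 r)) :=
        lintegral_mono' (UnitaryCayley.pi_mono _ _ fun _ => hcomp) le_rfl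

/-! ### Small balls have Haar measure `≥ C δ^D` -/

omit [IsTopologicalGroup G] [MeasurableSpace G] [BorelSpace G] [Fintype ι] in
/-- The chart image of a ball around `0` lies in the Hilbert–Schmidt ball of the same radius. [cite: arXiv160201222, Cor. 11.3] -/
theorem image_expChart_closedBall_zero_subset (hρ : Continuous ρ) (hinj : Function.Injective ρ) (r : ℝ) :
    expChart ρ '' closedBall (0 : (EuclideanSpace ℝ (Fin (dimE ρ)))) r ⊆ {g : G | ‖ρ g - 1‖ ≤ r} := by
  intro g hg
  have h := image_expChart_closedBall_subset ρ hρ 0 r hg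
  rwa [mem_setOf_eq, expChart_zero ρ hρ hinj, map_one] at h

/-- **Small balls have Haar measure `≥ C δ^D`** (Chatterjee Cor. 6.3, lower bound, soft constant): there
is `C > 0` with `σ(B(1,δ)) ≥ C δ^D` for `0 < δ ≤ 1`. [cite: arXiv160201222, Cor. 6.3] -/
theorem exists_haar_gball_ge (hρ : Continuous ρ) (hinj : Function.Injective ρ)
    (hU : ∀ g, ρ g ∈ Matrix.unitaryGroup (Fin N) ℂ) :
    ∃ C : ℝ, 0 < C ∧ ∀ δ : ℝ, 0 < δ → δ ≤ 1 →
      ENNReal.ofReal (C * δ ^ dimE ρ) ≤ haarProbability G {g : G | ‖ρ g - 1‖ ≤ δ} := by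
  obtain ⟨hc0, hctop, hT⟩ := haarConstE_spec ρ hρ hinj hU
  set c : ℝ≥0 := (haarConstE ρ).toNNReal with hcdef
  have hcc : (c : ℝ≥0∞) = haarConstE ρ := ENNReal.coe_toNNReal hctop
  have hc : 0 < c := by
    refine pos_iff_ne_zero.2 fun h0 => hc0 ?_
    rw [← hcc, h0, ENNReal.coe_zero]
  have hev : ∀ᶠ δ in 𝓝[>] (0 : ℝ), ((c / 2 : ℝ≥0) : ℝ≥0∞) < ballRatioE ρ δ := by
    refine hT.eventually_const_lt ?_
    rw [← hcc]; exact_mod_cast half_lt_self hc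
  obtain ⟨δ₀, hδ₀, hδ₀P⟩ : ∃ δ₀ > 0, ∀ δ, 0 < δ → δ ≤ δ₀ →
      ((c / 2 : ℝ≥0) : ℝ≥0∞) < ballRatioE ρ δ := by
    rw [eventually_nhdsWithin_iff, Metric.eventually_nhds_iff] at hev
    obtain ⟨ε, hε, h⟩ := hev
    refine ⟨ε / 2, half_pos hε, fun δ hδ hδε => h ?_ hδ⟩
    rw [Real.dist_eq, sub_zero, abs_of_pos hδ]; linarith
  set V₁ := volume (closedBall (0 : (EuclideanSpace ℝ (Fin (dimE ρ)))) 1) with hV₁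
  have hV₁fin : V₁ ≠ ∞ := (volume_closedBall_fin_lt_top _ _).ne
  have hV₁pos : V₁ ≠ 0 := (volume_closedBall_fin_pos _ one_pos).ne'
  set C : ℝ := (c / 2 : ℝ≥0) * V₁.toReal * (min δ₀ 1) ^ dimE ρ with hC
  have hCpos : 0 < C := by
    have : 0 < V₁.toReal := ENNReal.toReal_pos hV₁pos hV₁fin
    have : (0 : ℝ) < (c / 2 : ℝ≥0) := by exact_mod_cast half_pos hc
    positivity
  refine ⟨C, hCpos, fun δ hδ hδ1 => ?_⟩
  set δ' := min δ₀ 1 * δ with hδ'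
  have hm0 : 0 < min δ₀ 1 := lt_min hδ₀ one_pos
  have hδ'pos : 0 < δ' := mul_pos hm0 hδ
  have hδ'le : δ' ≤ δ₀ := by
    rw [hδ']
    calc min δ₀ 1 * δ ≤ min δ₀ 1 * 1 := mul_le_mul_of_nonneg_left hδ1 hm0.le
      _ ≤ δ₀ := by rw [mul_one]; exact min_le_left _ _
  have hδ'δ : δ' ≤ δ := by
    rw [hδ']
    calc min δ₀ 1 * δ ≤ 1 * δ := mul_le_mul_of_nonneg_right (min_le_right _ _) hδ.le
      _ = δ := one_mul δ
  have h1 := (hδ₀P δ' hδ'pos hδ'le).le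
  rw [ballRatioE, ENNReal.le_div_iff_mul_le (Or.inl (volume_closedBall_fin_pos _ hδ'pos).ne')
    (Or.inl (volume_closedBall_fin_lt_top _ _).ne), volume_closedBall_fin _ hδ'pos.le] at h1
  refine le_trans ?_ (h1.trans (measure_mono (gball_mono ρ hδ'δ)))
  rw [hC, hδ', mul_pow, ← hV₁]
  have e : ENNReal.ofReal ((c / 2 : ℝ≥0) * V₁.toReal * min δ₀ 1 ^ dimE ρ * δ ^ dimE ρ)
      = ((c / 2 : ℝ≥0) : ℝ≥0∞) * (ENNReal.ofReal (min δ₀ 1 ^ dimE ρ * δ ^ dimE ρ) * V₁) := by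
    rw [show ((c / 2 : ℝ≥0) : ℝ) * V₁.toReal * min δ₀ 1 ^ dimE ρ * δ ^ dimE ρ =
        (c / 2 : ℝ≥0) * ((min δ₀ 1 ^ dimE ρ * δ ^ dimE ρ) * V₁.toReal) by ring,
      ENNReal.ofReal_mul (by positivity), ENNReal.ofReal_coe_nnreal,
      ENNReal.ofReal_mul (by positivity), ENNReal.ofReal_toReal hV₁fin]
  rw [e]

end Compare

/-! ### The registered stub: the exponential chart package -/

section Package

variable {N : ℕ} {G : Type*} [Group G] [TopologicalSpace G] [IsTopologicalGroup G] [CompactSpace G]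
  [MeasurableSpace G] [BorelSpace G]

/-- **STUB 2 of line `Sketch` — the exponential chart package of a compact matrix group** (soft Haar
constant; Chatterjee Thm. 11.1, Cor. 11.3, Cor. 6.3 for `ρ(G) ≤ U(N)` in the exponential chart of
`𝔤_ρ`). [cite: arXiv160201222, Thm. 11.1, Cor. 11.3, Cor. 6.3] -/
theorem stub_expChartPackage [SecondCountableTopology G] (ρ : G →* Matrix (Fin N) (Fin N) ℂ)
    (hρ : Continuous ρ) (hinj : Function.Injective ρ)
    (hU : ∀ g, ρ g ∈ Matrix.unitaryGroup (Fin N) ℂ) :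
    Continuous (expChart ρ) ∧ (∀ a, ρ (expChart ρ a) = NormedSpace.exp (lieIso ρ a)) ∧
    (∀ a, (lieIso ρ a)ᴴ = -(lieIso ρ a)) ∧
    dimE ρ = Module.finrank ℝ ↥(matrixLieAlgebra (Set.range ρ)) ∧
    ∃ (cH r₁ C₁ : ℝ), 0 < cH ∧ 0 < r₁ ∧ r₁ ≤ 1 / 2 ∧ 0 < C₁ ∧
      (∀ r : ℝ, 0 ≤ r → r ≤ r₁ → 1 ≤ κE r ∧ κE r ≤ 2 ∧ Real.log (κE r) ≤ 16 * r) ∧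
      (∀ δ : ℝ, 0 < δ → δ ≤ 1 →
        ENNReal.ofReal (C₁ * δ ^ dimE ρ) ≤ haarProbability G {g : G | ‖ρ g - 1‖ ≤ δ}) ∧
      (∀ r : ℝ, 0 ≤ r → r ≤ r₁ → {g : G | ‖ρ g - 1‖ ≤ r / κE r} ⊆ expChart ρ '' Metric.closedBall 0 r) ∧
      (∀ (ι : Type) [Fintype ι] (r : ℝ), 0 < r → r ≤ r₁ → ∀ F : (ι → G) → ℝ≥0∞, Measurable F →
        ∫⁻ U in Set.pi Set.univ (fun _ => expChart ρ '' Metric.closedBall 0 r), F U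
            ∂(Measure.pi fun _ : ι => haarProbability G) ≤
          ENNReal.ofReal cH ^ Fintype.card ι *
            ∫⁻ a in Set.pi Set.univ
              (fun _ => Metric.closedBall (0 : EuclideanSpace ℝ (Fin (dimE ρ))) r),
              F (fun i => expChart ρ (a i))) ∧
      (∀ (ι : Type) [Fintype ι] (r : ℝ), 0 < r → r ≤ r₁ → ∀ F : (ι → G) → ℝ≥0∞, Measurable F →
        ((ENNReal.ofReal (κE r ^ dimE ρ))⁻¹ * ENNReal.ofReal cH) ^ Fintype.card ι *
            ∫⁻ a in Set.pi Set.univ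
              (fun _ => Metric.closedBall (0 : EuclideanSpace ℝ (Fin (dimE ρ))) r),
              F (fun i => expChart ρ (a i)) ≤
          ∫⁻ U in Set.pi Set.univ (fun _ => expChart ρ '' Metric.closedBall 0 r), F U
            ∂(Measure.pi fun _ : ι => haarProbability G)) := by
  obtain ⟨hc0, hctop, -⟩ := haarConstE_spec ρ hρ hinj hU
  obtain ⟨r₁, hr₁0, hr₁, hsurj⟩ := exists_chartRadius ρ hρ hinj hU
  obtain ⟨C₁, hC₁, hball⟩ := exists_haar_gball_ge ρ hρ hinj hU
  have hcH : ENNReal.ofReal (haarConstE ρ).toReal = haarConstE ρ := ENNReal.ofReal_toReal hctop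
  refine ⟨continuous_expChart ρ hρ hinj, rho_expChart ρ hρ, conjTranspose_lieIso ρ, dimE_eq_finrank ρ hU,
    (haarConstE ρ).toReal, r₁, C₁, ENNReal.toReal_pos hc0 hctop, hr₁0, by linarith, hC₁,
    fun r hr0 hr => ⟨one_le_κE hr0, κE_le_two r, log_κE_le hr0 (hr.trans hr₁)⟩, hball,
    fun r hr0 hr => ?_, fun ι _ r hr hrr F hF => ?_, fun ι _ r hr hrr F hF => ?_⟩
  · have h := setOf_norm_sub_le_subset_image_expChart ρ hρ hr₁ hsurj hinj hr (a := 0)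
      (by simpa using hr0) hr0 le_rfl
    rwa [expChart_zero ρ hρ hinj, map_one] at h
  · rw [hcH]
    exact lintegral_pi_image_expChart_le ρ hρ hinj hU (by linarith [hrr.trans hr₁]) hF
  · rw [hcH]
    exact le_lintegral_pi_image_expChart ρ hρ hinj hU hr₁ hsurj hr hrr hF

end Package
-- BODY END

end Summit.QuantumFields.YangMills.Theorems.FreeEnergyLogCoefficient

end
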